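import Summits.CriticalPhenomena.PercolationContinuityZ3.Theorems.Transplant.FKConnectivityAllQAntipodalTwoSpineDiag
import HarnessLib

/-!
# Two-spine word model of `U¹¹` — RESOLVING a diagram statement into statements of sub-diagrams

Theorem file (`--supports stmt-CriticalPhenomena-4575`), FK sub-lane `prim-bschramm-fk-2` (gen 15); builds on p205010 (kernel
theorem, internal audit signed; external expert review pending).  No named facts, no sorries.

A RESOLUTION of a diagram `D` is a list of pieces `(P, f, c)`: a diagram `P`, a map `f` of its nodes into the nodes of `D` and an
exponent offset `c`, such that (i) the node maps together enumerate every node of `D` exactly once, (ii) node `a` of `P` carries the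
modes of node `f a` of `D` and its exponent minus `c`, (iii) every order constraint `(a, b)` of `P` is IMPLIED in `D`: `f b` is
reachable from `f a` along `D.le`.  All three are decidable (`FK.TwoSpine.Resolution.check`).  **`FK.TwoSpine.DStmt.of_resolution`**:
if the check passes and every piece's statement holds for the shapes `(oA, oB)`, then `D`'s statement holds for `(oA, oB)` — the
diagram sum splits along the pieces and a `D`-admissible family restricts to a `P`-admissible one (order along reachability,
`FK.TwoSpine.Admissible.le_of_reach`).  With `…TwoSpineDiag` this is the complete induction step of the mode induction (memo g15 §6).
[cite: Grimmett2006, §3.8 (pp. 61–62)]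
-/

noncomputable section

namespace Summit.CriticalPhenomena.PercolationContinuityZ3.Theorems

namespace FK

namespace TwoSpine

open X2Word

/-! ### Reachability along the order constraints -/

/-- One step of Boolean reachability propagation: `j` is reached if it was, or if some reached `i` has `(i, j) ∈ le`. [folklore] -/
def reachStep (le : List (ℕ × ℕ)) (R : ℕ → Bool) : ℕ → Bool :=
  fun j => R j || le.any fun p => R p.1 && decide (p.2 = j)

/-- `reachable le n i j`: `j` is reachable from `i` along `le` in at most `n` steps (computable closure). [folklore] -/
def reachable (le : List (ℕ × ℕ)) (n i j : ℕ) : Bool :=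
  ((reachStep le)^[n] fun x => decide (x = i)) j

/-- Order along reachability: an admissible family is monotone along every `le`-path. [folklore] -/
theorem Admissible.le_of_reach {D : Diagram} {S : ℕ → List SLetter → List SLetter → ℝ} (hS : Admissible D S)
    (n i j : ℕ) (h : reachable D.le n i j = true) (u v : List SLetter) : S i u v ≤ S j u v := by
  induction n generalizing j with
  | zero =>
    simp only [reachable, Function.iterate_zero, id_eq, decide_eq_true_eq] at h
    rw [h]
  | succ n ih =>
    simp only [reachable, Function.iterate_succ_apply'] at h
    unfold reachStep at h
    simp only [Bool.or_eq_true, List.any_eq_true, Bool.and_eq_true, decide_eq_true_eq] at h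
    rcases h with h | ⟨p, hp, h1, rfl⟩
    · exact ih j h
    · exact (ih p.1 h1).trans (hS.le p hp u v)

/-! ### Resolutions and their check -/

/-- A PIECE of a resolution: a sub-diagram, the positions of its nodes in the big diagram, an exponent offset. [folklore] -/
structure Piece where
  /-- the sub-diagram -/
  P : Diagram
  /-- node `a` of `P` is node `f[a]` of the resolved diagram -/
  f : List ℕ
  /-- exponent offset: node `f[a]` carries the exponent of node `a` plus `c` -/
  c : ℕ

/-- The decidable CHECK of a resolution of `D` by `pieces` (conditions (i)–(iii) of the file header). [folklore] -/
def Resolution.check (D : Diagram) (pieces : List Piece) : Bool :=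
  decide ((pieces.flatMap fun pc => pc.f).Perm (List.range D.nodes.length)) &&
  pieces.all fun pc =>
    decide (pc.f.length = pc.P.nodes.length) &&
    (List.range pc.P.nodes.length).all (fun a =>
      decide (D.nodes.getD (pc.f.getD a 0) dfltNode = ((pc.P.nodes.getD a dfltNode).1, (pc.P.nodes.getD a dfltNode).2 + pc.c))) &&
    pc.P.le.all fun ab => reachable D.le D.le.length (pc.f.getD ab.1 0) (pc.f.getD ab.2 0)

/-- The family restricted to a piece: node `a` of the piece reads node `f[a]`. [folklore] -/
def famPiece (pc : Piece) (S : ℕ → List SLetter → List SLetter → ℝ) : ℕ → List SLetter → List SLetter → ℝ :=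
  fun a => S (pc.f.getD a 0)

/-- A `D`-admissible family restricts to a `P`-admissible one when `P`'s constraints are implied in `D`. [folklore] -/
theorem Admissible.piece {D : Diagram} {S : ℕ → List SLetter → List SLetter → ℝ} (hS : Admissible D S) (pc : Piece)
    (hle : ∀ ab ∈ pc.P.le, reachable D.le D.le.length (pc.f.getD ab.1 0) (pc.f.getD ab.2 0) = true) :
    Admissible pc.P (famPiece pc S) where
  nonneg _ _ _ := hS.nonneg _ _ _
  monoA _ _ _ _ h := hS.monoA _ _ _ _ h
  monoB _ _ _ _ h := hS.monoB _ _ _ _ h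
  le ab hab u v := hS.le_of_reach _ _ _ (hle ab hab) u v

/-- The summand of node `n` of `D` in `dsum`. [folklore] -/
def nodeTerm (q : ℝ) (top : Top) (D : Diagram) (oA oB : List Kind) (S : ℕ → List SLetter → List SLetter → ℝ) (n : ℕ) : ℝ :=
  q ^ (D.nodes.getD n dfltNode).2 * ∑ u ∈ kindWords oA, ∑ v ∈ kindWords oB, theta q top (D.nodes.getD n dfltNode).1 u v * S n u v

/-- `dsum` as a list sum over `range`. [folklore] -/
theorem dsum_eq_list_sum (q : ℝ) (top : Top) (D : Diagram) (oA oB : List Kind) (S : ℕ → List SLetter → List SLetter → ℝ) :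
    dsum q top D oA oB S = ((List.range D.nodes.length).map (nodeTerm q top D oA oB S)).sum := by
  rw [dsum_eq, ← List.sum_toFinset _ List.nodup_range, List.toFinset_range]
  rfl

/-- The piece sum is the corresponding part of the big sum, up to the factor `q^c`. [folklore] -/
theorem dsum_piece (q : ℝ) (top : Top) (D : Diagram) (oA oB : List Kind) (S : ℕ → List SLetter → List SLetter → ℝ) (pc : Piece)
    (hlen : pc.f.length = pc.P.nodes.length)
    (hlab : ∀ a < pc.P.nodes.length,
      D.nodes.getD (pc.f.getD a 0) dfltNode = ((pc.P.nodes.getD a dfltNode).1, (pc.P.nodes.getD a dfltNode).2 + pc.c)) :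
    (pc.f.map (nodeTerm q top D oA oB S)).sum = q ^ pc.c * dsum q top pc.P oA oB (famPiece pc S) := by
  rw [dsum_eq_list_sum, ← List.sum_map_mul_left]
  have hf : pc.f = (List.range pc.P.nodes.length).map fun a => pc.f.getD a 0 := by
    rw [← hlen]
    refine List.ext_getElem (by simp) fun n h₁ h₂ => ?_
    simp [List.getD_eq_getElem?_getD, List.getElem?_eq_getElem h₁]
  conv_lhs => rw [hf, List.map_map]
  refine congrArg List.sum (List.map_congr_left fun a ha => ?_)
  rw [List.mem_range] at ha
  simp only [Function.comp, nodeTerm, hlab a ha, famPiece, pow_add]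
  ring

/-- **RESOLUTION SOUNDNESS**: a checked resolution reduces the statement of `D` to the statements of its pieces (memo g15 §6). [folklore] -/
theorem DStmt.of_resolution {q : ℝ} (hq : 0 ≤ q) {top : Top} {D : Diagram} {pieces : List Piece} (hc : Resolution.check D pieces = true)
    {oA oB : List Kind} (hP : ∀ pc ∈ pieces, DStmt q top pc.P oA oB) : DStmt q top D oA oB := by
  intro S hS
  unfold Resolution.check at hc
  simp only [Bool.and_eq_true, decide_eq_true_eq, List.all_eq_true, List.mem_range] at hc
  obtain ⟨hperm, hpc⟩ := hc
  rw [dsum_eq_list_sum, ← (hperm.map (nodeTerm q top D oA oB S)).sum_eq, List.map_flatMap, List.flatMap_def, List.sum_flatten,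
    List.map_map]
  refine List.sum_nonneg (fun x hx => ?_)
  rw [List.mem_map] at hx
  obtain ⟨pc, hpc', rfl⟩ := hx
  obtain ⟨⟨hlen, hlab⟩, hle⟩ := hpc pc hpc'
  show 0 ≤ (pc.f.map (nodeTerm q top D oA oB S)).sum
  rw [dsum_piece q top D oA oB S pc hlen hlab]
  exact mul_nonneg (pow_nonneg hq _) (hP pc hpc' _ (hS.piece pc hle))

end TwoSpine

end FK

end Summit.CriticalPhenomena.PercolationContinuityZ3.Theorems

end
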